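import Mathlib
import Summits.NavierStokesRegularity.NavierStokesRegularity.Theorems.TaoLadderRungTwoFlatBehindHop
import HarnessLib

/-!
# BEHIND START 55 — L-55a: the DISJOINT-UNION start bound for the behind block energy under ruling R54-1
  (helper for the K_A♭ parent item stmt-NavierStokesRegularity-22987 `FlatGapCertificatesV2`, child 2A
  `GradedAdiabaticWake` of route TaoLadderRungTwoFlat; cell harvest/h2-tao-ladder, theory-1 g43, memo W-START-55 /
  LADDER §55; TRAP #11 and its cure)

PROVENANCE (p1 g22): theory-1 g43's image of record numT55/BehindStart55.lean sha16 2f14f69a24709fd8 (farm `lean check` rc 0 · 0 sorry · 0 warnings),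
landed with declarations BYTE-IDENTICAL (helper for the K_A♭ parent item stmt-NavierStokesRegularity-22987; TRAP #11 cure L-55a: the ENERGY-ADDITIVE,
L-uniform start for `R54.behindEnergyClause_hop_of_pseudoFlow`, replacing the use of p1's amplitude-additive `sqrt_initial_blockEnergy_le`); the image's
module docstring follows verbatim.

TRAP #11 (lemma level). The landed start lemma `HopTube.R54.sqrt_initial_blockEnergy_le`
(`√V₀ ≤ √(W n) + a_K + √L·r_k`) is TRUE but cannot close the R54-1 schedule: (i) `√L·r_k` has no bound uniform in the
block depth `L`, while (B1) is a clause for EVERY `L`; (ii) the deposit `a_K` of the core's bottom shell enters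
AMPLITUDE-additively, so the squared recursion carries the cross term `2a_K√W` of order `ε₀·√W` per hop against a
transport deficit `θ′s·W = O(ε₀)·W`: the fixed point is `√W_∞ ≈ a_K/(θ′s) = O(1)`, independent of `ε₀`, and the
transport race (K8′) `√(2W̄) < σ/((1+ε)c̄)` is lost for every `ε₀` (NUM-T55a: lost by hop ≤ 12 on the whole grid
`10⁻³ ≤ ε₀ ≤ 10⁻¹`, even without kicks).

CURE L-55a (this file). The entering shell `−K` is DISJOINT from the old behind block `[1−K−L, −K−1]`, so the
block energy of the state is ADDITIVE: `V(z) ≤ W n + a_K²` (no square roots taken of the parts); Minkowski is used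
only once, for the adversarial kick, and with the WEIGHTED sum `Σ_{j<L} e^{−θ′j} ≤ 1/(1 − e^{−θ′})`, uniform in `L`:

  `√V_{[1−K−L,−K]}^{−K}(S)(0) ≤ √(W n + a_K²) + r_k/√(1 − e^{−θ′})`          (`sqrt_initial_blockEnergy_le_additive`)

and its squared (energy) form `initial_blockEnergy_le_additive`, which is the `hV₀` input of
`HopTube.R54.behind_hop_of_pseudoFlow`. The resulting schedule in energy form,
`a_n²W(n+1) = e^{−θ′s_n}(√(W(n)+a_K(n)²) + r_k/√(1−e^{−θ′}))² + I_n^{edge}`, has `W_∞ = O(ε₀)` iff the kick exponent is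
`p ≥ 2` (`r = r₁θ₀ε₀^p`; of record `p = 3`) — ERRATUM-55 to LADDER §54.2 ("p ≥ 1" → "p ≥ 2").

* `landing_weight_sum_le` — `Σ_{k ∈ [1−K−L,−K]} e^{θ′(k+K)} ≤ 1/(1 − e^{−θ′})` for `θ′ > 0`, uniform in `L`;
* `kickEnergy_le` — a field bounded by `r_k` on the landing block has weighted energy `≤ r_k²/(1 − e^{−θ′})`;
* `stateEnergy_landingBlock_le` — (B1) + the bottom-shell amplitude: `V(z) ≤ W n + a_K²` (disjoint union);
* `sqrt_initial_blockEnergy_le_additive`, `initial_blockEnergy_le_additive` — L-55a in amplitude and energy form.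

HONEST FRAMING: inequalities about MODEL-lattice certificate flows (Tao 2016 §4 vocabulary, graded mirror table on `S♭`,
`m = 2`); every bound is a HYPOTHESIS; nothing certified; no item closed; nothing about the Navier–Stokes equations.
-/

noncomputable section

-- the sub-problem namespace repeats the summit name by design (D-0017)
set_option linter.dupNamespace false

namespace Summit.NavierStokesRegularity.NavierStokesRegularity.Theorems.HopTube.R54

open Set Finset Literature.Analysis.FluidPDE Literature.Analysis.FluidPDE.TaoCascade MirrorPulse

/-! ## 1. The landing-block weights, uniform in the depth `L` -/

/-- **WEIGHT SUM ON THE LANDING BLOCK**, uniform in `L`: with reference point `−K` the shells `−K, −K−1, …, 1−K−L` carry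
weights `1, e^{−θ′}, …, e^{−θ′(L−1)}`, so `Σ_{k=1−K−L}^{−K} e^{θ′(k+K)} ≤ 1/(1 − e^{−θ′})` for `θ′ > 0`
(`≈ 1/(2θ_b′ε₀)` for `θ′ = 2θ_b′·ln(1+ε₀)`). [folklore (geometric series); cell LADDER §55 (L-55a)] -/
theorem landing_weight_sum_le {θ' : ℝ} (hθ : 0 < θ') (K L : ℕ) :
    ∑ k ∈ Finset.Icc (1 - (K : ℤ) - L) (-(K : ℤ)), Real.exp (θ' * ((k : ℝ) - -(K : ℝ)))
      ≤ 1 / (1 - Real.exp (-θ')) := by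
  classical
  -- re-index `k = −K − j`, `j < L`
  have himg : Finset.Icc (1 - (K : ℤ) - L) (-(K : ℤ))
      = (Finset.range L).image (fun j : ℕ => -(K : ℤ) - j) := by
    ext k
    simp only [Finset.mem_Icc, Finset.mem_image, Finset.mem_range]
    constructor
    · rintro ⟨h1, h2⟩
      exact ⟨(-(K : ℤ) - k).toNat, by omega, by omega⟩
    · rintro ⟨j, hj, rfl⟩
      constructor <;> omega
  have hinj : Set.InjOn (fun j : ℕ => -(K : ℤ) - j) (Finset.range L : Set ℕ) := by
    intro a _ b _ h
    have h' : (-(K : ℤ) - a : ℤ) = -(K : ℤ) - b := h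
    omega
  rw [himg, Finset.sum_image hinj]
  have hq0 : 0 ≤ Real.exp (-θ') := (Real.exp_pos _).le
  have hq1 : Real.exp (-θ') < 1 := Real.exp_lt_one_iff.mpr (by linarith)
  calc ∑ j ∈ Finset.range L, Real.exp (θ' * (((-(K : ℤ) - (j : ℕ) : ℤ) : ℝ) - -(K : ℝ)))
      = ∑ j ∈ Finset.range L, Real.exp (-θ') ^ j := by
        refine Finset.sum_congr rfl fun j _ => ?_
        rw [← Real.exp_nat_mul]
        congr 1
        push_cast
        ring
    _ ≤ Real.exp (-θ') ^ 0 / (1 - Real.exp (-θ')) := by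
        rw [Finset.range_eq_Ico]
        exact geom_sum_Ico_le_of_lt_one hq0 hq1
    _ = 1 / (1 - Real.exp (-θ')) := by rw [pow_zero]

/-- **KICK ENERGY ON THE LANDING BLOCK**, uniform in `L`: a field bounded shellwise by `r_k` on the landing block
`[1−K−L, −K]` has weighted energy (reference `−K`) `≤ r_k²/(1 − e^{−θ′})`. Replaces the `L·r_k²` of
`sqrt_initial_blockEnergy_le`, which is not uniform in `L`. [folklore (geometric series); cell LADDER §55 (L-55a)] -/
theorem kickEnergy_le {K L : ℕ} {θ' rk : ℝ} (hθ : 0 < θ') {v : Fin 2 → ℤ → ℝ → ℝ} {t : ℝ}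
    (hv : ∀ i, ∀ k ∈ Finset.Icc (1 - (K : ℤ) - L) (-(K : ℤ)), |v i k t| ≤ rk) :
    coMovingEnergyOn (Finset.Icc (1 - (K : ℤ) - L) (-(K : ℤ))) θ' (-(K : ℝ)) v t
      ≤ rk ^ 2 / (1 - Real.exp (-θ')) := by
  unfold coMovingEnergyOn
  calc ∑ k ∈ Finset.Icc (1 - (K : ℤ) - L) (-(K : ℤ)), Real.exp (θ' * ((k : ℝ) - -(K : ℝ)))
          * ((v 0 k t ^ 2 + v 1 k t ^ 2) / 2)
      ≤ ∑ k ∈ Finset.Icc (1 - (K : ℤ) - L) (-(K : ℤ)), Real.exp (θ' * ((k : ℝ) - -(K : ℝ))) * rk ^ 2 := by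
        refine Finset.sum_le_sum fun k hk => ?_
        have hs0 : ∀ i, v i k t ^ 2 ≤ rk ^ 2 := fun i => by
          rw [← sq_abs]
          exact pow_le_pow_left₀ (abs_nonneg _) (hv i k hk) 2
        have hs : (v 0 k t ^ 2 + v 1 k t ^ 2) / 2 ≤ rk ^ 2 := by linarith [hs0 0, hs0 1]
        exact mul_le_mul_of_nonneg_left hs (Real.exp_pos _).le
    _ = (∑ k ∈ Finset.Icc (1 - (K : ℤ) - L) (-(K : ℤ)), Real.exp (θ' * ((k : ℝ) - -(K : ℝ)))) * rk ^ 2 := by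
        rw [Finset.sum_mul]
    _ ≤ 1 / (1 - Real.exp (-θ')) * rk ^ 2 :=
        mul_le_mul_of_nonneg_right (landing_weight_sum_le hθ K L) (sq_nonneg _)
    _ = rk ^ 2 / (1 - Real.exp (-θ')) := by ring

/-! ## 2. The state on the landing block: DISJOINT UNION, energy additive -/

/-- **THE STATE'S ENERGY ON THE LANDING BLOCK IS ADDITIVE**: the landing block `[1−K−L, −K]` is the disjoint union of
(part of) the old behind block `[−K−L, −K−1]`, of weighted energy `≤ W n` by (B1), and the single shell `−K` (weight
`1`, both species of amplitude `≤ a_K`): `V(z) ≤ W n + a_K²` — no square roots of the parts. (This is the inequality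
`hE₁` inside the proof of `sqrt_initial_blockEnergy_le`, promoted to a lemma because the schedule must use it in this
form.) [cite: Tao2016AveragedNS, §4 (4.3) (energy); route TaoLadderRungTwoFlat, R54-1 (B1), cell LADDER §55 (L-55a)] -/
theorem stateEnergy_landingBlock_le {K L : ℕ} {θ' Wn aK : ℝ} (hθ : 0 ≤ θ') {z : Fin 2 → ℤ → ℝ}
    (hW : BehindEnergyClause K θ' Wn z) (hWn : 0 ≤ Wn) (haK : ∀ i, |z i (-(K : ℤ))| ≤ aK) :
    coMovingEnergyOn (Finset.Icc (1 - (K : ℤ) - L) (-(K : ℤ))) θ' (-(K : ℝ)) (fun i k _ => z i k) 0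
      ≤ Wn + aK ^ 2 := by
  by_cases hL : L = 0
  · subst hL
    unfold coMovingEnergyOn
    rw [Finset.Icc_eq_empty (by push_cast; omega), Finset.sum_empty]
    positivity
  have hL1 : 1 ≤ L := Nat.one_le_iff_ne_zero.mpr hL
  have h1L : (1 : ℤ) ≤ (L : ℤ) := by exact_mod_cast hL1
  have hsucc := coMovingEnergyOn_Icc_succ_le (a := 1 - (K : ℤ) - L) (P := -(K : ℤ) - 1) (θ := θ')
    (ne := -(K : ℝ)) (by omega) hθ (by push_cast; linarith) (fun i k _ => z i k) 0
  simp only [sub_add_cancel] at hsucc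
  have hblk : coMovingEnergyOn (Finset.Icc (1 - (K : ℤ) - L) (-(K : ℤ) - 1)) θ' (-(K : ℝ)) (fun i k _ => z i k) 0
      ≤ Wn := by
    have hsub : Finset.Icc (1 - (K : ℤ) - L) (-(K : ℤ) - 1) ⊆ behindBlock K L := by
      unfold behindBlock
      exact Finset.Icc_subset_Icc (by omega) le_rfl
    exact (coMovingEnergyOn_mono hsub θ' (-(K : ℝ)) _ 0).trans (hW L)
  have htop : ((fun (i : Fin 2) (k : ℤ) (_ : ℝ) => z i k) 0 (-(K : ℤ)) 0 ^ 2
      + (fun (i : Fin 2) (k : ℤ) (_ : ℝ) => z i k) 1 (-(K : ℤ)) 0 ^ 2) / 2 ≤ aK ^ 2 := by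
    have h0 : z 0 (-(K : ℤ)) ^ 2 ≤ aK ^ 2 := by
      rw [← sq_abs]; exact pow_le_pow_left₀ (abs_nonneg _) (haK 0) 2
    have h1 : z 1 (-(K : ℤ)) ^ 2 ≤ aK ^ 2 := by
      rw [← sq_abs]; exact pow_le_pow_left₀ (abs_nonneg _) (haK 1) 2
    show (z 0 (-(K : ℤ)) ^ 2 + z 1 (-(K : ℤ)) ^ 2) / 2 ≤ aK ^ 2
    linarith
  linarith

/-! ## 3. L-55a: the start bound in amplitude and in energy form -/

/-- **L-55a — THE INITIAL BLOCK ENERGY, DISJOINT-UNION FORM.** With `S(0) = S₀`, the (B1) clause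
`BehindEnergyClause K θ′ (W n) z`, the amplitude `a_K` of the state at the window bottom `−K` and the kick
`|S₀ − z| ≤ r_k` on the landing block:
`√V_{[1−K−L,−K]}^{−K}(S)(0) ≤ √(W n + a_K²) + r_k/√(1 − e^{−θ′})`, uniform in `L`.
Use THIS (not `sqrt_initial_blockEnergy_le`) as the start of the R54-1 schedule: squared, the deposit `a_K²` is
energy-additive and the only Minkowski cross term is the kick's. [cite: Tao2016AveragedNS, §4 (4.3), §6.3–6.4 (statement shape); route TaoLadderRungTwoFlat, R54-1 schedule in energy form (LADDER §54.8, §55), TRAP #11 cure] -/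
theorem sqrt_initial_blockEnergy_le_additive {K L : ℕ} {θ' Wn aK rk : ℝ} {z S₀ : Fin 2 → ℤ → ℝ}
    {S : Fin 2 → ℤ → ℝ → ℝ} (hS0 : ∀ i k, S i k 0 = S₀ i k) (hθ : 0 < θ')
    (hW : BehindEnergyClause K θ' Wn z) (hWn : 0 ≤ Wn)
    (haK : ∀ i, |z i (-(K : ℤ))| ≤ aK)
    (hkick : ∀ i, ∀ k ∈ Finset.Icc (1 - (K : ℤ) - L) (-(K : ℤ)), |S₀ i k - z i k| ≤ rk) (hrk : 0 ≤ rk) :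
    Real.sqrt (coMovingEnergyOn (Finset.Icc (1 - (K : ℤ) - L) (-(K : ℤ))) θ' (-(K : ℝ)) S 0)
      ≤ Real.sqrt (Wn + aK ^ 2) + rk / Real.sqrt (1 - Real.exp (-θ')) := by
  -- split `S₀ = z + (S₀ − z)` on the block
  have hsplit : coMovingEnergyOn (Finset.Icc (1 - (K : ℤ) - L) (-(K : ℤ))) θ' (-(K : ℝ)) S 0
      = coMovingEnergyOn (Finset.Icc (1 - (K : ℤ) - L) (-(K : ℤ))) θ' (-(K : ℝ))
          ((fun i k _ => z i k) + fun i k _ => S₀ i k - z i k) 0 := by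
    refine coMovingEnergyOn_congr_at fun i k _ => ?_
    simp only [Pi.add_apply, hS0]
    ring
  -- piece 1 (additive): the state
  have hE₁ := stateEnergy_landingBlock_le (L := L) hθ.le hW hWn haK
  -- piece 2: the kick, weighted sum uniform in `L`
  have hE₂ : coMovingEnergyOn (Finset.Icc (1 - (K : ℤ) - L) (-(K : ℤ))) θ' (-(K : ℝ))
      (fun i k _ => S₀ i k - z i k) 0 ≤ rk ^ 2 / (1 - Real.exp (-θ')) :=
    kickEnergy_le (v := fun i k _ => S₀ i k - z i k) (t := 0) hθ fun i k hk => hkick i k hk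
  -- Minkowski once
  have hm := sqrt_coMovingEnergyOn_add_le (Finset.Icc (1 - (K : ℤ) - L) (-(K : ℤ))) θ' (-(K : ℝ))
    (fun i k _ => z i k) (fun i k _ => S₀ i k - z i k) 0
  have hs₁ : Real.sqrt (coMovingEnergyOn (Finset.Icc (1 - (K : ℤ) - L) (-(K : ℤ))) θ' (-(K : ℝ))
        (fun i k _ => z i k) 0) ≤ Real.sqrt (Wn + aK ^ 2) := Real.sqrt_le_sqrt hE₁
  have hs₂ : Real.sqrt (coMovingEnergyOn (Finset.Icc (1 - (K : ℤ) - L) (-(K : ℤ))) θ' (-(K : ℝ))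
        (fun i k _ => S₀ i k - z i k) 0) ≤ rk / Real.sqrt (1 - Real.exp (-θ')) := by
    refine (Real.sqrt_le_sqrt hE₂).trans (le_of_eq ?_)
    rw [Real.sqrt_div (sq_nonneg rk), Real.sqrt_sq hrk]
  rw [hsplit]
  linarith

/-- **L-55a, ENERGY FORM** (the `hV₀` input of `behind_hop_of_pseudoFlow`):
`V_{[1−K−L,−K]}^{−K}(S)(0) ≤ (√(W n + a_K²) + r_k/√(1 − e^{−θ′}))²`; with no kick (`r_k = 0`) this is exactly
`W n + a_K²`. The R54-1 schedule then reads `a_n²·W(n+1) = e^{−μτ₁}·(√(W n + a_K²) + r_k/√(1−e^{−θ′}))² + Ē(1−e^{−μτ₁})/μ`.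
[cite: Tao2016AveragedNS, §4 (4.3), §6.3–6.4 (statement shape); route TaoLadderRungTwoFlat, R54-1 schedule in energy form (LADDER §55), ERRATUM-55] -/
theorem initial_blockEnergy_le_additive {K L : ℕ} {θ' Wn aK rk : ℝ} {z S₀ : Fin 2 → ℤ → ℝ}
    {S : Fin 2 → ℤ → ℝ → ℝ} (hS0 : ∀ i k, S i k 0 = S₀ i k) (hθ : 0 < θ')
    (hW : BehindEnergyClause K θ' Wn z) (hWn : 0 ≤ Wn)
    (haK : ∀ i, |z i (-(K : ℤ))| ≤ aK)
    (hkick : ∀ i, ∀ k ∈ Finset.Icc (1 - (K : ℤ) - L) (-(K : ℤ)), |S₀ i k - z i k| ≤ rk) (hrk : 0 ≤ rk) :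
    coMovingEnergyOn (Finset.Icc (1 - (K : ℤ) - L) (-(K : ℤ))) θ' (-(K : ℝ)) S 0
      ≤ (Real.sqrt (Wn + aK ^ 2) + rk / Real.sqrt (1 - Real.exp (-θ'))) ^ 2 := by
  have h := sqrt_initial_blockEnergy_le_additive hS0 hθ hW hWn haK hkick hrk
  have hV := coMovingEnergyOn_nonneg (Finset.Icc (1 - (K : ℤ) - L) (-(K : ℤ))) θ' (-(K : ℝ)) S 0
  calc coMovingEnergyOn (Finset.Icc (1 - (K : ℤ) - L) (-(K : ℤ))) θ' (-(K : ℝ)) S 0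
      = Real.sqrt (coMovingEnergyOn (Finset.Icc (1 - (K : ℤ) - L) (-(K : ℤ))) θ' (-(K : ℝ)) S 0) ^ 2 :=
        (Real.sq_sqrt hV).symm
    _ ≤ (Real.sqrt (Wn + aK ^ 2) + rk / Real.sqrt (1 - Real.exp (-θ'))) ^ 2 :=
        pow_le_pow_left₀ (Real.sqrt_nonneg _) h 2

/-- **NO-KICK COROLLARY**: if the initial datum agrees with the state on the landing block, the initial block energy is
`≤ W n + a_K²` — the disjoint-union additivity that the schedule of record (LADDER §54.8) uses.
[cite: Tao2016AveragedNS, §4 (4.3); route TaoLadderRungTwoFlat, R54-1 schedule in energy form (LADDER §55)] -/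
theorem initial_blockEnergy_le_of_noKick {K L : ℕ} {θ' Wn aK : ℝ} {z S₀ : Fin 2 → ℤ → ℝ}
    {S : Fin 2 → ℤ → ℝ → ℝ} (hS0 : ∀ i k, S i k 0 = S₀ i k) (hθ : 0 < θ')
    (hW : BehindEnergyClause K θ' Wn z) (hWn : 0 ≤ Wn)
    (haK : ∀ i, |z i (-(K : ℤ))| ≤ aK)
    (hagree : ∀ i, ∀ k ∈ Finset.Icc (1 - (K : ℤ) - L) (-(K : ℤ)), S₀ i k = z i k) :
    coMovingEnergyOn (Finset.Icc (1 - (K : ℤ) - L) (-(K : ℤ))) θ' (-(K : ℝ)) S 0 ≤ Wn + aK ^ 2 := by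
  have hkick : ∀ i, ∀ k ∈ Finset.Icc (1 - (K : ℤ) - L) (-(K : ℤ)), |S₀ i k - z i k| ≤ 0 := by
    intro i k hk
    rw [hagree i k hk, sub_self, abs_zero]
  have h := initial_blockEnergy_le_additive hS0 hθ hW hWn haK hkick le_rfl
  have haK0 : 0 ≤ aK := (abs_nonneg _).trans (haK 0)
  have hpos : 0 ≤ Wn + aK ^ 2 := by positivity
  simpa [zero_div, add_zero, Real.sq_sqrt hpos] using h

end Summit.NavierStokesRegularity.NavierStokesRegularity.Theorems.HopTube.R54

end
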